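import Mathlib.Algebra.Field.ZMod
import Mathlib.Algebra.Module.ZMod
import Mathlib.FieldTheory.Finiteness
import Mathlib.LinearAlgebra.Dimension.Free
import Mathlib.NumberTheory.Padics.ProperSpace
import Mathlib.NumberTheory.Padics.RingHoms
import Mathlib.Topology.Algebra.ContinuousMonoidHom
import Mathlib.Topology.Algebra.IsUniformGroup.Basic
import Mathlib.Topology.Algebra.Group.Pointwise
import HarnessLib

/-!
# Compact abelian groups which are free `ℤ_p`-modules of finite rank (proofs only, no definitions)

A topological criterion for a compact abelian group to be `ℤ_pⁿ`, used to discharge the named fact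
`Literature.NumberTheory.EllipticCurves.PRamified.exists_openSubgroup_localUnits_equiv` ("`U_p` contains an open subgroup of finite
index isomorphic to `ℤ_p^{[K:ℚ]}`", Lang, *Cyclotomic Fields I and II*, Ch. 5 §5, p. 107) in
`ZpExtensionLocalUnitsProofs.lean`:

* `ZpRankCriterion.nonempty_continuousAddEquiv`: let `A` be a compact Hausdorff abelian topological
  group and `p` a prime such that (i) `pʲA → 0` uniformly (every neighbourhood of `0` contains
  `pʲ A` for some `j`), (ii) `p a = 0 → a = 0`, and (iii) `[A : pA] = pⁿ`.  Then `A ≅ ℤ_pⁿ` as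
  topological groups;
* `ZpRankCriterion.nonempty_continuousMulEquiv`: the same for multiplicatively written groups
  (`G ≃ₜ* Multiplicative (Fin n → ℤ_[p])`).

This is the standard structure theory of abelian pro-`p` groups (a compact abelian group with (i)
is a topological `ℤ_p`-module; with (ii) it is torsion free; (iii) and a Nakayama/density argument
make it free of rank `n`), cf. Neukirch, *Algebraic Number Theory*, Ch. II (5.7) and Washington,
*Introduction to Cyclotomic Fields*, §13.1–13.2, where it is applied to the principal local units.
The proof here is self-contained and elementary: the `ℤ_p`-action `x • a = lim_k (x mod pᵏ) • a`
(a Cauchy sequence in the compact, hence complete, uniform group `A`) is handled through its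
defining limit (no `Module` instance is registered: no definitions in this file); a basis of the
`𝔽_p`-vector space `A/pA` is lifted to `a₁, …, aₙ ∈ A`; the continuous homomorphism
`Φ : ℤ_pⁿ → A`, `x ↦ ∑ xᵢ • aᵢ` is injective by `p`-adic descent using (ii), has compact (closed)
and dense image (`A = Φ(ℤ_pⁿ) + pᵏA` for all `k`), hence is a continuous bijection from a compact
space to a Hausdorff space, i.e. a homeomorphism.

## References

* J. Neukirch, *Algebraic Number Theory*, Springer 1999, Ch. II §5, (5.7).
* [Washington1997] L. C. Washington, *Introduction to Cyclotomic Fields*, 2nd ed., GTM 83,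
  Springer 1997, §13.1 (proof of Thm. 13.4: `U_{1,𝔭} ≃ (finite) × ℤ_p^{[K_𝔭:ℚ_p]}`).
* [Lang1990] S. Lang, *Cyclotomic Fields I and II*, GTM 121, Springer 1990, Ch. 5 §5, p. 107.
-/

noncomputable section

open Filter Topology

namespace Literature.NumberTheory.EllipticCurves

namespace ZpExtension

namespace ZpRankCriterion

variable {p : ℕ} [Fact p.Prime]

/-! ### `p`-adic congruences of integers -/

/-- An integer is divisible by `pᵏ` if its image in `ℤ_p` lies in `pᵏℤ_p`. [folklore] -/
theorem dvd_of_intCast_mem_span {m : ℤ} {k : ℕ}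
    (h : ((m : ℤ_[p])) ∈ Ideal.span {(p : ℤ_[p]) ^ k}) : (p ^ k : ℤ) ∣ m := by
  rwa [← PadicInt.norm_le_pow_iff_mem_span_pow, PadicInt.norm_int_le_pow_iff_dvd] at h

/-- `x ≡ x.appr k (mod pᵏ)` with the approximation cast through `ℤ`. [folklore] -/
theorem sub_intCast_appr_mem (x : ℤ_[p]) (k : ℕ) :
    x - ((x.appr k : ℤ) : ℤ_[p]) ∈ Ideal.span {(p : ℤ_[p]) ^ k} := by
  rw [Int.cast_natCast]
  exact PadicInt.appr_spec k x

/-- `pˡℤ_p ⊆ pᵏℤ_p` for `k ≤ l`. [folklore] -/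
theorem span_pow_le {k l : ℕ} (h : k ≤ l) :
    Ideal.span {(p : ℤ_[p]) ^ l} ≤ Ideal.span {(p : ℤ_[p]) ^ k} :=
  Ideal.span_singleton_le_span_singleton.2 (pow_dvd_pow _ h)

/-- If `x ≡ m`, `y ≡ m'` and `x ≡ y (mod pᵏ)` then `pᵏ ∣ m - m'`. [folklore] -/
theorem dvd_sub_of_sub_mem_span {m m' : ℤ} {x y : ℤ_[p]} {k : ℕ}
    (hx : x - m ∈ Ideal.span {(p : ℤ_[p]) ^ k}) (hy : y - m' ∈ Ideal.span {(p : ℤ_[p]) ^ k})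
    (hxy : x - y ∈ Ideal.span {(p : ℤ_[p]) ^ k}) : (p ^ k : ℤ) ∣ m - m' := by
  apply dvd_of_intCast_mem_span
  have : ((m - m' : ℤ) : ℤ_[p]) = (x - y) - (x - m) + (y - m') := by
    push_cast
    ring
  rw [this]
  exact Ideal.add_mem _ (Ideal.sub_mem _ hxy hx) hy

/-- `x.appr l ≡ x.appr k (mod pᵏ)` for `k ≤ l`. [folklore] -/
theorem dvd_appr_sub_appr (x : ℤ_[p]) {k l : ℕ} (h : k ≤ l) :
    (p ^ k : ℤ) ∣ (x.appr l : ℤ) - x.appr k :=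
  dvd_sub_of_sub_mem_span (span_pow_le h (sub_intCast_appr_mem x l))
    (sub_intCast_appr_mem x k) (by simp)

/-- A non-zero `p`-adic integer does not lie in every `pᵏℤ_p`. [folklore] -/
theorem eq_zero_of_forall_mem_span {x : ℤ_[p]}
    (h : ∀ k : ℕ, x ∈ Ideal.span {(p : ℤ_[p]) ^ k}) : x = 0 := by
  by_contra hx
  have := (PadicInt.mem_span_pow_iff_le_valuation x hx (x.valuation + 1)).1 (h _)
  omega

variable {A : Type*} [AddCommGroup A] [TopologicalSpace A] [IsTopologicalAddGroup A]

/-! ### Small subgroups `pʲA` -/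

omit [Fact p.Prime] [IsTopologicalAddGroup A] in
/-- A sequence whose `k`-th term lies in `pᵏA` tends to `0` when `pʲA → 0`. [folklore] -/
theorem tendsto_zero_of_eq_pow_smul
    (hsmall : ∀ U ∈ 𝓝 (0 : A), ∃ j : ℕ, ∀ c : A, (p ^ j : ℕ) • c ∈ U)
    {u : ℕ → A} {k₀ : ℕ} (hu : ∀ k, k₀ ≤ k → ∃ c : A, u k = (p ^ k : ℕ) • c) :
    Tendsto u atTop (𝓝 0) := by
  rw [tendsto_atTop_nhds]
  intro U h0 hUo
  obtain ⟨j, hj⟩ := hsmall U (hUo.mem_nhds h0)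
  refine ⟨max k₀ j, fun k hk => ?_⟩
  obtain ⟨c, hc⟩ := hu k (le_of_max_le_left hk)
  obtain ⟨d, rfl⟩ := Nat.exists_eq_add_of_le (le_of_max_le_right hk)
  rw [hc, pow_add, mul_smul]
  exact hj _

omit [Fact p.Prime] [IsTopologicalAddGroup A] in
/-- If `pᵏ` divides the integer coefficient `mₖ` of the `k`-th term, the sequence `mₖ • a` tends
to `0` (when `pʲA → 0`). [folklore] -/
theorem tendsto_zero_of_dvd_coeff
    (hsmall : ∀ U ∈ 𝓝 (0 : A), ∃ j : ℕ, ∀ c : A, (p ^ j : ℕ) • c ∈ U)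
    {m : ℕ → ℤ} (a : A) (hm : ∀ k, (p ^ k : ℤ) ∣ m k) :
    Tendsto (fun k => m k • a) atTop (𝓝 0) := by
  refine tendsto_zero_of_eq_pow_smul hsmall (k₀ := 0) fun k _ => ?_
  obtain ⟨c, hc⟩ := hm k
  refine ⟨c • a, ?_⟩
  rw [hc, mul_smul, ← Nat.cast_pow, natCast_zsmul]

omit [Fact p.Prime] [IsTopologicalAddGroup A] in
/-- A limit of elements of `pʲA` lies in the closure of `pʲA`. [folklore] -/
theorem mem_closure_of_tendsto_of_dvd {u : ℕ → ℤ} {a b : A} {j k₀ : ℕ}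
    (hu : Tendsto (fun k => u k • a) atTop (𝓝 b)) (hdvd : ∀ k, k₀ ≤ k → (p ^ j : ℤ) ∣ u k) :
    b ∈ closure (Set.range fun c : A => (p ^ j : ℕ) • c) := by
  refine mem_closure_of_tendsto hu (eventually_atTop.2 ⟨k₀, fun k hk => ?_⟩)
  obtain ⟨c, hc⟩ := hdvd k hk
  refine ⟨c • a, ?_⟩
  change (p ^ j : ℕ) • (c • a) = u k • a
  rw [hc, mul_smul, ← Nat.cast_pow, natCast_zsmul]

omit [Fact p.Prime] in
/-- Every neighbourhood of `0` contains the closure of some `pʲA` (topological groups are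
regular). [folklore] -/
theorem exists_closure_subset
    (hsmall : ∀ U ∈ 𝓝 (0 : A), ∃ j : ℕ, ∀ c : A, (p ^ j : ℕ) • c ∈ U)
    {U : Set A} (hU : U ∈ 𝓝 (0 : A)) :
    ∃ j : ℕ, closure (Set.range fun c : A => (p ^ j : ℕ) • c) ⊆ U := by
  obtain ⟨C, ⟨hC, hCc⟩, hCU⟩ := (closed_nhds_basis (0 : A)).mem_iff.1 hU
  obtain ⟨j, hj⟩ := hsmall C hC
  refine ⟨j, (closure_minimal ?_ hCc).trans hCU⟩
  rintro _ ⟨c, rfl⟩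
  exact hj c

/-! ### The `ℤ_p`-action through its defining limit

Throughout, `F : ℤ_[p] → A → A` is *any* function with
`F x a = lim_k (x.appr k) • a`; its existence for compact `A` is `exists_action` below. -/

section Action

variable {F : ℤ_[p] → A → A}

/-- `F x a - F y a ∈ closure (pʲA)` if `x ≡ y (mod pʲ)`. [folklore] -/
theorem action_sub_mem_closure
    (hF : ∀ (x : ℤ_[p]) (a : A), Tendsto (fun k => (x.appr k : ℤ) • a) atTop (𝓝 (F x a)))
    {x y : ℤ_[p]} {j : ℕ} (hxy : x - y ∈ Ideal.span {(p : ℤ_[p]) ^ j}) (a : A) :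
    F x a - F y a ∈ closure (Set.range fun c : A => (p ^ j : ℕ) • c) := by
  have h : Tendsto (fun k => ((x.appr k : ℤ) - y.appr k) • a) atTop (𝓝 (F x a - F y a)) := by
    simpa only [sub_smul] using (hF x a).sub (hF y a)
  refine mem_closure_of_tendsto_of_dvd h (k₀ := j) fun k hk => ?_
  exact dvd_sub_of_sub_mem_span (span_pow_le hk (sub_intCast_appr_mem x k))
    (span_pow_le hk (sub_intCast_appr_mem y k)) hxy

/-- `a ↦ F x a` is additive. [folklore] -/
theorem action_add_right [T2Space A]
    (hF : ∀ (x : ℤ_[p]) (a : A), Tendsto (fun k => (x.appr k : ℤ) • a) atTop (𝓝 (F x a)))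
    (x : ℤ_[p]) (a b : A) : F x (a + b) = F x a + F x b := by
  have h : Tendsto (fun k => (x.appr k : ℤ) • (a + b)) atTop (𝓝 (F x a + F x b)) := by
    simpa only [smul_add] using (hF x a).add (hF x b)
  exact tendsto_nhds_unique (hF x (a + b)) h

/-- `F x 0 = 0`. [folklore] -/
theorem action_zero_right [T2Space A]
    (hF : ∀ (x : ℤ_[p]) (a : A), Tendsto (fun k => (x.appr k : ℤ) • a) atTop (𝓝 (F x a)))
    (x : ℤ_[p]) : F x 0 = 0 := by
  have h := action_add_right hF x 0 0
  rw [add_zero] at h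
  have h' : F x 0 + F x 0 = F x 0 + 0 := by rw [add_zero]; exact h.symm
  exact add_left_cancel h'

/-- `F x (-a) = -F x a`. [folklore] -/
theorem action_neg_right [T2Space A]
    (hF : ∀ (x : ℤ_[p]) (a : A), Tendsto (fun k => (x.appr k : ℤ) • a) atTop (𝓝 (F x a)))
    (x : ℤ_[p]) (a : A) : F x (-a) = -F x a := by
  have h := action_add_right hF x (-a) a
  rw [neg_add_cancel, action_zero_right hF] at h
  exact (neg_eq_of_add_eq_zero_left h.symm).symm

/-- `F x (m • a) = m • F x a` for `m : ℕ`. [folklore] -/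
theorem action_nsmul_right [T2Space A]
    (hF : ∀ (x : ℤ_[p]) (a : A), Tendsto (fun k => (x.appr k : ℤ) • a) atTop (𝓝 (F x a)))
    (x : ℤ_[p]) (m : ℕ) (a : A) : F x (m • a) = m • F x a := by
  induction m with
  | zero => rw [zero_smul, zero_smul, action_zero_right hF]
  | succ m ih => rw [succ_nsmul, action_add_right hF, ih, succ_nsmul]

/-- `F m a = m • a` for `m : ℕ` (the action extends the `ℕ`-action). [folklore] -/
theorem action_natCast [T2Space A]
    (hsmall : ∀ U ∈ 𝓝 (0 : A), ∃ j : ℕ, ∀ c : A, (p ^ j : ℕ) • c ∈ U)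
    (hF : ∀ (x : ℤ_[p]) (a : A), Tendsto (fun k => (x.appr k : ℤ) • a) atTop (𝓝 (F x a)))
    (m : ℕ) (a : A) : F m a = m • a := by
  have h1 : Tendsto (fun k => (((m : ℤ_[p]).appr k : ℤ) - m) • a) atTop (𝓝 0) := by
    refine tendsto_zero_of_dvd_coeff hsmall a fun k => ?_
    exact dvd_sub_of_sub_mem_span (x := (m : ℤ_[p])) (y := (m : ℤ_[p]))
      (sub_intCast_appr_mem _ k) (by simp) (by simp)
  have h2 : Tendsto (fun k => (((m : ℤ_[p]).appr k : ℤ) - m) • a + (m : ℤ) • a) atTop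
      (𝓝 (0 + (m : ℤ) • a)) := h1.add tendsto_const_nhds
  simp only [sub_smul, sub_add_cancel, zero_add] at h2
  rw [← natCast_zsmul]
  exact tendsto_nhds_unique (hF m a) h2

/-- `F 0 a = 0`. [folklore] -/
theorem action_zero_left [T2Space A]
    (hsmall : ∀ U ∈ 𝓝 (0 : A), ∃ j : ℕ, ∀ c : A, (p ^ j : ℕ) • c ∈ U)
    (hF : ∀ (x : ℤ_[p]) (a : A), Tendsto (fun k => (x.appr k : ℤ) • a) atTop (𝓝 (F x a)))
    (a : A) : F 0 a = 0 := by
  have h := action_natCast hsmall hF 0 a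
  rwa [Nat.cast_zero, zero_smul] at h

/-- `x ↦ F x a` is additive. [folklore] -/
theorem action_add_left [T2Space A]
    (hsmall : ∀ U ∈ 𝓝 (0 : A), ∃ j : ℕ, ∀ c : A, (p ^ j : ℕ) • c ∈ U)
    (hF : ∀ (x : ℤ_[p]) (a : A), Tendsto (fun k => (x.appr k : ℤ) • a) atTop (𝓝 (F x a)))
    (x y : ℤ_[p]) (a : A) : F (x + y) a = F x a + F y a := by
  have h1 : Tendsto (fun k => (((x + y).appr k : ℤ) - (x.appr k + y.appr k)) • a) atTop (𝓝 0) := by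
    refine tendsto_zero_of_dvd_coeff hsmall a fun k => ?_
    refine dvd_sub_of_sub_mem_span (x := x + y) (y := x + y) (sub_intCast_appr_mem _ k) ?_
      (by simp)
    have : x + y - ((x.appr k + y.appr k : ℤ) : ℤ_[p]) =
        (x - (x.appr k : ℤ)) + (y - (y.appr k : ℤ)) := by
      push_cast
      ring
    rw [this]
    exact Ideal.add_mem _ (sub_intCast_appr_mem x k) (sub_intCast_appr_mem y k)
  have h2 : Tendsto
      (fun k => (((x + y).appr k : ℤ) - (x.appr k + y.appr k)) • a +
        ((x.appr k : ℤ) • a + (y.appr k : ℤ) • a)) atTop (𝓝 (0 + (F x a + F y a))) :=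
    h1.add ((hF x a).add (hF y a))
  simp only [sub_smul, add_smul, sub_add_cancel, zero_add] at h2
  exact tendsto_nhds_unique (hF (x + y) a) h2

/-- `F (m * x) a = m • F x a` for `m : ℕ`. [folklore] -/
theorem action_natCast_mul [T2Space A]
    (hsmall : ∀ U ∈ 𝓝 (0 : A), ∃ j : ℕ, ∀ c : A, (p ^ j : ℕ) • c ∈ U)
    (hF : ∀ (x : ℤ_[p]) (a : A), Tendsto (fun k => (x.appr k : ℤ) • a) atTop (𝓝 (F x a)))
    (m : ℕ) (x : ℤ_[p]) (a : A) : F (m * x) a = m • F x a := by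
  induction m with
  | zero => rw [Nat.cast_zero, zero_mul, zero_smul, action_zero_left hsmall hF]
  | succ m ih =>
    rw [Nat.cast_succ, add_mul, one_mul, action_add_left hsmall hF, ih, succ_nsmul]

/-- `x ↦ F x a` is continuous. [folklore] -/
theorem continuous_action
    (hsmall : ∀ U ∈ 𝓝 (0 : A), ∃ j : ℕ, ∀ c : A, (p ^ j : ℕ) • c ∈ U)
    (hF : ∀ (x : ℤ_[p]) (a : A), Tendsto (fun k => (x.appr k : ℤ) • a) atTop (𝓝 (F x a)))
    (a : A) : Continuous fun x => F x a := by
  refine continuous_iff_continuousAt.2 fun x₀ => ?_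
  rw [ContinuousAt, tendsto_def]
  intro U hU
  have hV : {c : A | F x₀ a - c ∈ U} ∈ 𝓝 (0 : A) := by
    have hc : Continuous fun c : A => F x₀ a - c := continuous_const.sub continuous_id
    exact hc.continuousAt.preimage_mem_nhds (by simpa using hU)
  obtain ⟨j, hj⟩ := exists_closure_subset hsmall hV
  have hball : Metric.closedBall x₀ ((p : ℝ) ^ (-(j : ℤ))) ∈ 𝓝 x₀ :=
    Metric.closedBall_mem_nhds _ (zpow_pos (by exact_mod_cast (Fact.out : p.Prime).pos) _)
  refine Filter.mem_of_superset hball fun x hx => ?_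
  have hxy : x₀ - x ∈ Ideal.span {(p : ℤ_[p]) ^ j} := by
    rw [← PadicInt.norm_le_pow_iff_mem_span_pow, ← dist_eq_norm, dist_comm]
    exact hx
  have hmem := hj (action_sub_mem_closure hF hxy a)
  simpa using hmem

/-- `F (x * y) a = F x (F y a)` (the action is associative; by density of `ℕ` in `ℤ_p`).
[folklore] -/
theorem action_mul [T2Space A]
    (hsmall : ∀ U ∈ 𝓝 (0 : A), ∃ j : ℕ, ∀ c : A, (p ^ j : ℕ) • c ∈ U)
    (hF : ∀ (x : ℤ_[p]) (a : A), Tendsto (fun k => (x.appr k : ℤ) • a) atTop (𝓝 (F x a)))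
    (x y : ℤ_[p]) (a : A) : F (x * y) a = F x (F y a) := by
  have hcl : IsClosed {x : ℤ_[p] | F (x * y) a = F x (F y a)} :=
    isClosed_eq ((continuous_action hsmall hF a).comp (continuous_id.mul continuous_const))
      (continuous_action hsmall hF (F y a))
  refine PadicInt.denseRange_natCast.induction_on x hcl fun m => ?_
  change F (m * y) a = F m (F y a)
  rw [action_natCast_mul hsmall hF, action_natCast hsmall hF]

/-- `F (m + p * z) a = m • a + p • F z a` for `m : ℕ`. [folklore] -/
theorem action_natCast_add_prime_mul [T2Space A]
    (hsmall : ∀ U ∈ 𝓝 (0 : A), ∃ j : ℕ, ∀ c : A, (p ^ j : ℕ) • c ∈ U)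
    (hF : ∀ (x : ℤ_[p]) (a : A), Tendsto (fun k => (x.appr k : ℤ) • a) atTop (𝓝 (F x a)))
    (m : ℕ) (z : ℤ_[p]) (a : A) : F (m + p * z) a = m • a + p • F z a := by
  rw [action_add_left hsmall hF, action_natCast hsmall hF, action_natCast_mul hsmall hF]

end Action

/-- **Existence of the `ℤ_p`-action.**  In a compact Hausdorff abelian group with `pʲA → 0`, for
every `x ∈ ℤ_p` and `a ∈ A` the sequence `(x.appr k) • a` converges (it is Cauchy for the
canonical uniform structure, and compact uniform spaces are complete). [folklore] -/
theorem exists_action [CompactSpace A]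
    (hsmall : ∀ U ∈ 𝓝 (0 : A), ∃ j : ℕ, ∀ c : A, (p ^ j : ℕ) • c ∈ U) :
    ∃ F : ℤ_[p] → A → A,
      ∀ (x : ℤ_[p]) (a : A), Tendsto (fun k => (x.appr k : ℤ) • a) atTop (𝓝 (F x a)) := by
  letI : UniformSpace A := IsTopologicalAddGroup.rightUniformSpace A
  haveI : IsUniformAddGroup A := isUniformAddGroup_of_addCommGroup
  have key : ∀ (x : ℤ_[p]) (a : A), ∃ b, Tendsto (fun k => (x.appr k : ℤ) • a) atTop (𝓝 b) := by
    intro x a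
    apply cauchySeq_tendsto_of_complete
    rw [cauchySeq_iff]
    intro V hV
    rw [uniformity_eq_comap_nhds_zero'] at hV
    obtain ⟨U, hU, hUV⟩ := hV
    obtain ⟨j, hj⟩ := hsmall U hU
    refine ⟨j, fun k hk l hl => hUV ?_⟩
    simp only [Set.mem_preimage]
    have hdvd : (p ^ j : ℤ) ∣ (x.appr l : ℤ) - x.appr k := by
      have h := (dvd_appr_sub_appr x hl).sub (dvd_appr_sub_appr x hk)
      rwa [sub_sub_sub_cancel_right] at h
    obtain ⟨c, hc⟩ := hdvd
    have : (x.appr l : ℤ) • a + -((x.appr k : ℤ) • a) = (p ^ j : ℕ) • (c • a) := by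
      rw [← sub_eq_add_neg, ← sub_smul, hc, mul_smul, ← Nat.cast_pow, natCast_zsmul]
    rw [this]
    exact hj _
  choose F hF using key
  exact ⟨F, hF⟩

/-! ### A basis of `A/pA` lifted to `A` -/

omit [TopologicalSpace A] [IsTopologicalAddGroup A] in
/-- If `[A : pA] = pⁿ` then there are `a₁, …, aₙ ∈ A` whose images form an `𝔽_p`-basis of `A/pA`:
every element of `A` is an `ℕ`-combination of the `aᵢ` modulo `pA`, and an integer combination
lying in `pA` has all coefficients divisible by `p`. [folklore] -/
theorem exists_lift_basis {n : ℕ} (P : AddSubgroup A) (hP : ∀ a, a ∈ P ↔ ∃ b, a = p • b)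
    (hind : P.index = p ^ n) :
    ∃ e : Fin n → A,
      (∀ b : A, ∃ c : Fin n → ℕ, b - ∑ i, c i • e i ∈ P) ∧
      (∀ c : Fin n → ℤ, ∑ i, c i • e i ∈ P → ∀ i, (p : ℤ) ∣ c i) := by
  classical
  have hp : p.Prime := Fact.out
  -- `haveI`, not `letI`: a `let`-bound instance makes coercion search on `Module.Basis` get stuck
  haveI : Module (ZMod p) (A ⧸ P) :=
    QuotientAddGroup.zmodModule (fun x => (hP _).2 ⟨x, rfl⟩)
  haveI : Finite (A ⧸ P) := by
    apply Nat.finite_of_card_ne_zero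
    change P.index ≠ 0
    rw [hind]
    exact pow_ne_zero _ hp.ne_zero
  haveI : Module.Finite (ZMod p) (A ⧸ P) := Module.Finite.of_finite
  have hrank : Module.finrank (ZMod p) (A ⧸ P) = n := by
    have h : Nat.card (A ⧸ P) = Nat.card (ZMod p) ^ Module.finrank (ZMod p) (A ⧸ P) :=
      Module.natCard_eq_pow_finrank
    rw [Nat.card_zmod] at h
    change P.index = _ at h
    rw [hind] at h
    exact (Nat.pow_right_injective hp.two_le h).symm
  let bQ := Module.finBasisOfFinrankEq (ZMod p) (A ⧸ P) hrank
  let e : Fin n → A := fun i =>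
    Classical.choose (QuotientAddGroup.mk_surjective (bQ i : A ⧸ P))
  have he : ∀ i, (QuotientAddGroup.mk (e i) : A ⧸ P) = (bQ i : A ⧸ P) := fun i =>
    Classical.choose_spec (QuotientAddGroup.mk_surjective (bQ i : A ⧸ P))
  have hmk_sum_nat : ∀ c : Fin n → ℕ,
      (QuotientAddGroup.mk (∑ i, c i • e i) : A ⧸ P) = ∑ i, (c i : ZMod p) • bQ i := by
    intro c
    rw [← QuotientAddGroup.mk'_apply, map_sum]
    refine Finset.sum_congr rfl fun i _ => ?_
    rw [map_nsmul, QuotientAddGroup.mk'_apply, he, Nat.cast_smul_eq_nsmul]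
  have hmk_sum_int : ∀ c : Fin n → ℤ,
      (QuotientAddGroup.mk (∑ i, c i • e i) : A ⧸ P) = ∑ i, (c i : ZMod p) • bQ i := by
    intro c
    rw [← QuotientAddGroup.mk'_apply, map_sum]
    refine Finset.sum_congr rfl fun i _ => ?_
    rw [map_zsmul, QuotientAddGroup.mk'_apply, he, Int.cast_smul_eq_zsmul]
  refine ⟨e, fun b => ?_, fun c hc i => ?_⟩
  · refine ⟨fun i => (bQ.repr (QuotientAddGroup.mk b) i).val, ?_⟩
    rw [← QuotientAddGroup.eq_zero_iff, ← QuotientAddGroup.mk'_apply, map_sub,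
      QuotientAddGroup.mk'_apply, QuotientAddGroup.mk'_apply, hmk_sum_nat, sub_eq_zero]
    simp only [ZMod.natCast_zmod_val]
    exact (bQ.sum_repr _).symm
  · have h0 : ∑ i, (c i : ZMod p) • bQ i = 0 := by
      rw [← hmk_sum_int, QuotientAddGroup.eq_zero_iff]
      exact hc
    have hli := Fintype.linearIndependent_iff.1 bQ.linearIndependent (fun i => (c i : ZMod p)) h0 i
    exact (ZMod.intCast_zmod_eq_zero_iff_dvd _ _).1 hli

/-! ### The criterion -/

/-- **A compact abelian group with `pʲA → 0`, no `p`-torsion and `[A : pA] = pⁿ` is `ℤ_pⁿ`** (as a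
topological group).  Structure theory of abelian pro-`p` groups; cf. Neukirch, *Algebraic Number
Theory*, Ch. II (5.7), Washington, *Introduction to Cyclotomic Fields*, §13.1. [folklore] -/
theorem nonempty_continuousAddEquiv [CompactSpace A] [T2Space A] {n : ℕ}
    (hsmall : ∀ U ∈ 𝓝 (0 : A), ∃ j : ℕ, ∀ c : A, (p ^ j : ℕ) • c ∈ U)
    (htf : ∀ a : A, p • a = 0 → a = 0)
    (P : AddSubgroup A) (hP : ∀ a, a ∈ P ↔ ∃ b, a = p • b) (hind : P.index = p ^ n) :
    Nonempty (A ≃ₜ+ (Fin n → ℤ_[p])) := by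
  classical
  obtain ⟨F, hF⟩ := exists_action (p := p) hsmall
  obtain ⟨e, hspan, hindep⟩ := exists_lift_basis P hP hind
  -- the continuous homomorphism `Φ x = ∑ F (x i) (e i)`
  let Φ : (Fin n → ℤ_[p]) →+ A :=
    { toFun := fun x => ∑ i, F (x i) (e i)
      map_zero' := by simp [action_zero_left hsmall hF]
      map_add' := fun x y => by
        simp only [Pi.add_apply, action_add_left hsmall hF, Finset.sum_add_distrib] }
  have hΦ : ∀ x, Φ x = ∑ i, F (x i) (e i) := fun x => rfl
  have hΦc : Continuous Φ := by
    change Continuous fun x : Fin n → ℤ_[p] => ∑ i, F (x i) (e i)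
    exact continuous_finsetSum _ fun i _ =>
      (continuous_action hsmall hF (e i)).comp (continuous_apply i)
  have hΦnat : ∀ c : Fin n → ℕ, Φ (fun i => (c i : ℤ_[p])) = ∑ i, c i • e i := fun c => by
    rw [hΦ]
    exact Finset.sum_congr rfl fun i _ => action_natCast hsmall hF _ _
  have hΦp : ∀ x : Fin n → ℤ_[p], Φ (fun i => (p : ℤ_[p]) * x i) = p • Φ x := fun x => by
    rw [hΦ, hΦ, Finset.smul_sum]
    exact Finset.sum_congr rfl fun i _ => action_natCast_mul hsmall hF p (x i) (e i)
  -- injectivity: `Φ x = 0` forces all coordinates into `pℤ_p`, then descend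
  have hstep : ∀ x : Fin n → ℤ_[p], Φ x = 0 →
      ∃ y : Fin n → ℤ_[p], (∀ i, x i = p * y i) ∧ Φ y = 0 := by
    intro x hx
    have hz : ∀ i, ∃ z : ℤ_[p], x i = (x i).appr 1 + p * z := fun i => by
      obtain ⟨z, hz⟩ := Ideal.mem_span_singleton'.1 (PadicInt.appr_spec 1 (x i))
      exact ⟨z, by rw [pow_one] at hz; linear_combination -hz⟩
    choose z hz using hz
    have hsum : Φ x = ∑ i, ((x i).appr 1 : ℤ) • e i + p • Φ z := by
      rw [hΦ, hΦ, Finset.smul_sum, ← Finset.sum_add_distrib]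
      refine Finset.sum_congr rfl fun i _ => ?_
      conv_lhs => rw [hz i]
      rw [action_natCast_add_prime_mul hsmall hF, natCast_zsmul]
    have hmem : ∑ i, ((x i).appr 1 : ℤ) • e i ∈ P := by
      rw [hP]
      refine ⟨-Φ z, ?_⟩
      have : ∑ i, ((x i).appr 1 : ℤ) • e i = Φ x - p • Φ z := by rw [hsum, add_sub_cancel_right]
      rw [this, hx, zero_sub, smul_neg]
    have hdvd := hindep _ hmem
    have hy : ∀ i, ∃ y : ℤ_[p], x i = p * y := fun i => by
      obtain ⟨q, hq⟩ := hdvd i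
      refine ⟨q + z i, ?_⟩
      have hcast : (((x i).appr 1 : ℕ) : ℤ_[p]) = (p : ℤ_[p]) * (q : ℤ_[p]) := by
        rw [← Int.cast_natCast, hq]
        push_cast
        ring
      rw [hz i, hcast]
      ring
    choose y hy using hy
    refine ⟨y, hy, htf _ ?_⟩
    rw [← hΦp, show (fun i => (p : ℤ_[p]) * y i) = x from funext fun i => (hy i).symm, hx]
  have hinj : Function.Injective Φ := by
    rw [injective_iff_map_eq_zero]
    intro x hx
    have hall : ∀ k : ℕ, ∀ x : Fin n → ℤ_[p], Φ x = 0 →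
        ∀ i, x i ∈ Ideal.span {(p : ℤ_[p]) ^ k} := by
      intro k
      induction k with
      | zero => intro x _ i; simp
      | succ k ih =>
        intro x hx i
        obtain ⟨y, hxy, hy⟩ := hstep x hx
        rw [hxy i, pow_succ', Ideal.mem_span_singleton]
        exact mul_dvd_mul_left _ (Ideal.mem_span_singleton.1 (ih y hy i))
    funext i
    exact eq_zero_of_forall_mem_span fun k => hall k x hx i
  -- surjectivity: the image is compact, hence closed, and dense
  have happrox : ∀ (k : ℕ) (a : A), ∃ (x : Fin n → ℤ_[p]) (c : A), a = Φ x + (p ^ k : ℕ) • c := by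
    intro k
    induction k with
    | zero => intro a; exact ⟨0, a, by simp⟩
    | succ k ih =>
      intro a
      obtain ⟨x, c, hac⟩ := ih a
      obtain ⟨c', hc'⟩ := hspan c
      obtain ⟨d, hd⟩ := (hP _).1 hc'
      refine ⟨x + fun i => ((p ^ k * c' i : ℕ) : ℤ_[p]), d, ?_⟩
      have hc : c = Φ (fun i => (c' i : ℤ_[p])) + p • d := by
        rw [hΦnat, ← hd]
        abel
      rw [hac, hc, map_add, smul_add, pow_succ, mul_smul, add_assoc]
      congr 2
      rw [← map_nsmul]
      congr 1
      funext i
      simp only [Pi.smul_apply, Nat.cast_mul, Nat.cast_pow, nsmul_eq_mul]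
  have hsurj : Function.Surjective Φ := by
    intro a
    have hclosed : IsClosed (Set.range Φ) := (isCompact_range hΦc).isClosed
    have hmem : a ∈ closure (Set.range Φ) := by
      rw [mem_closure_iff_nhds]
      intro U hU
      have hV : {c : A | a - c ∈ U} ∈ 𝓝 (0 : A) := by
        have hc : Continuous fun c : A => a - c := continuous_const.sub continuous_id
        exact hc.continuousAt.preimage_mem_nhds (by simpa using hU)
      obtain ⟨j, hj⟩ := hsmall _ hV
      obtain ⟨x, c, hac⟩ := happrox j a
      refine ⟨Φ x, ?_, x, rfl⟩
      have h := hj c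
      simp only [Set.mem_setOf_eq] at h
      rwa [hac, add_sub_cancel_right] at h
    rw [hclosed.closure_eq] at hmem
    exact hmem
  -- a continuous bijection from a compact space to a Hausdorff space is a homeomorphism
  let E : (Fin n → ℤ_[p]) ≃ A := Equiv.ofBijective Φ ⟨hinj, hsurj⟩
  have hE : Continuous E := hΦc
  let H : (Fin n → ℤ_[p]) ≃ₜ A := hE.homeoOfEquivCompactToT2
  let Ψ : A ≃+ (Fin n → ℤ_[p]) :=
    { H.symm.toEquiv with
      map_add' := fun a b => by
        apply H.injective
        change E (E.symm (a + b)) = Φ (E.symm a + E.symm b)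
        rw [Φ.map_add]
        change E (E.symm (a + b)) = E (E.symm a) + E (E.symm b)
        simp only [Equiv.apply_symm_apply] }
  exact ⟨{ Ψ with
      continuous_toFun := H.symm.continuous
      continuous_invFun := H.continuous }⟩

/-- **Multiplicative version**: a compact abelian group `G` with `g^{pʲ} → 1` uniformly, no
`p`-torsion and `[G : Gᵖ] = pⁿ` is `≅ ℤ_pⁿ` as a topological group.  Cf. Neukirch, *Algebraic
Number Theory*, Ch. II (5.7); Lang, *Cyclotomic Fields I and II*, Ch. 5 §5, p. 107.
[folklore] -/
theorem nonempty_continuousMulEquiv {G : Type*} [CommGroup G] [TopologicalSpace G]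
    [IsTopologicalGroup G] [CompactSpace G] [T2Space G] {n : ℕ}
    (hsmall : ∀ U ∈ 𝓝 (1 : G), ∃ j : ℕ, ∀ g : G, g ^ (p ^ j) ∈ U)
    (htf : ∀ g : G, g ^ p = 1 → g = 1)
    (P : Subgroup G) (hP : ∀ g, g ∈ P ↔ ∃ h, g = h ^ p) (hind : P.index = p ^ n) :
    Nonempty (G ≃ₜ* Multiplicative (Fin n → ℤ_[p])) := by
  haveI : T2Space (Additive G) := ‹T2Space G›
  obtain ⟨e⟩ := nonempty_continuousAddEquiv (A := Additive G) (p := p) (n := n)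
    (fun U hU => by
      obtain ⟨j, hj⟩ := hsmall U hU
      exact ⟨j, fun c => hj (Additive.toMul c)⟩)
    (fun a ha => htf (Additive.toMul a) ha)
    (Subgroup.toAddSubgroup P) (fun a => hP (Additive.toMul a))
    (by rw [Subgroup.index_toAddSubgroup, hind])
  let Ψ : G ≃* Multiplicative (Fin n → ℤ_[p]) :=
    { Additive.ofMul.trans (e.toEquiv.trans Multiplicative.ofAdd) with
      map_mul' := fun a b => by
        change Multiplicative.ofAdd (e (Additive.ofMul (a * b))) =
          Multiplicative.ofAdd (e (Additive.ofMul a)) * Multiplicative.ofAdd (e (Additive.ofMul b))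
        rw [ofMul_mul, map_add, ofAdd_add] }
  exact ⟨{ Ψ with
      continuous_toFun := continuous_ofAdd.comp (e.continuous.comp continuous_ofMul)
      continuous_invFun := continuous_toMul.comp (e.symm.continuous.comp continuous_toAdd) }⟩

end ZpRankCriterion

end ZpExtension

end Literature.NumberTheory.EllipticCurves
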